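import Mathlib.GroupTheory.QuotientGroup.Basic
import Mathlib.GroupTheory.Index
import HarnessLib

/-!
# The image of a stable subgroup under an equivariant homomorphism: order `= #T ⁄ #(T ∩ Ker)`, stability and torsion transported
# ([BourbakiAlgebraI1989] Ch. I §4 no. 2 Def. 2–3, no. 3 Def. 4, §4 no. 6 Th. 4 (c); [Tate1997FiniteFlatGroupSchemes] (3.7))

Topic `Literature/GroupTheory`; namespace `Literature.GroupTheory.StableSubgroups` (continues ★ (TR) `StableSubgroupsTransport`).  THEOREMS ONLY, Mathlib-only
(`Subgroup.map`, `QuotientGroup.quotientKerEquivRange`, Lagrange); no definition, no instance, no notation, no named fact, no `sorry`.  Cell `hodgecm-mathlib`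
(D-0151), programme P6 «MOD» (crux hLiu418 = stmt-HodgeConjecture-24832, `--supports`, count-neutral): line L2, organ `stub_SPGEOM`, piece **(ρ3b)-UP «THE IMAGE
LINE UPSTAIRS»** (LA2-plan (g0) «ρ-ROAD v2.1» (iii); payer LA6-p03 (g2)): the GEOMETRIC witness of the L2 letter [R] is `L_img := u(A_y[𝔭_{c•w}])`, the image of the
`𝔭_{c•w}`-torsion of `A_y(Ω̄)` under the (T𝒜) roof hom `u = q ≫ d_a : A_y → A_{y′}` — an `𝒪_F`-stable subgroup of `A_{y′}(Ω̄)` of order `q = q² ⁄ q` killed by `𝔭_{c•w}`,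
i.e. a member of the D-line carrier `LineOf I y′`, as soon as `u` is `𝒪_F`-equivariant and `Ker u ∩ A_y[𝔭_{c•w}] = L` has order `q`.  This file is the group
theory of that sentence, for ANY group homomorphism `u : M →* M′` intertwining two families of self-maps and any finite subgroup `T ≤ M`.  HC_CM is proved only
modulo the printed citations until rung 0 closes; this file is generic and changes no count.

THE MATHEMATICS.  For `u : M → M′` a homomorphism and `T ≤ M` a finite subgroup, `u|_T : T → u(T)` is onto with kernel `T ∩ Ker u`, so `#u(T) · #(T ∩ Ker u) = #T`
([BourbakiAlgebraI1989] I §4 no. 6 Th. 4 (c) with Lagrange).  If `u (f a x) = f′ a (u x)` for families of self-maps `f a : M → M`, `f′ a : M′ → M′` and `T` is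
`f`-stable, then `u(T)` is `f′`-stable; if every `x ∈ T` satisfies `f a x = 1` for `a ∈ 𝔞` and then every `y ∈ u(T)` satisfies `f′ a y = 1` for `a ∈ 𝔞`
(`u 1 = 1`) (groups with operators, [BourbakiAlgebraI1989] I §4 nos. 2–3).

* `natCard_map_mul_natCard_inf_ker` (`#u(T) · #(T ⊓ Ker u) = #T`), `natCard_map_eq_of_natCard_eq` (`#T = n·m`, `#(T ⊓ Ker u) = m` ⟹ `#u(T) = n`),
  `map_mem_map_of_semiconj` (stability transported), `forall_eq_one_of_mem_map` (torsion transported),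
  **`exists_stableSubgroup_image`** (the packaged member `⟨u(T), #=n, torsion, stable⟩` of the ★ (TR)-shaped carrier, with `((E).1 = T.map u)`).

## References
* [BourbakiAlgebraI1989] N. Bourbaki, *Algebra I. Chapters 1–3* (1989), Ch. I §4 no. 2 Def. 2–3, no. 3 Def. 4, no. 6 Th. 4.
* [Tate1997FiniteFlatGroupSchemes] J. Tate, *Finite flat group schemes* (1997), (3.7).
-/

set_option autoImplicit false

namespace Literature.GroupTheory.StableSubgroups

variable {M M' : Type*} [Group M] [Group M'] (u : M →* M') (T : Subgroup M)

/-- **`#u(T) · #(T ∩ Ker u) = #T`** for a homomorphism `u` and a subgroup `T` (first isomorphism theorem for `u|_T` + Lagrange).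
[cite: BourbakiAlgebraI1989, Ch. I §4 no. 6 Th. 4] -/
theorem natCard_map_mul_natCard_inf_ker : Nat.card (T.map u) * Nat.card ↥(T ⊓ u.ker) = Nat.card T := by
  -- `u|_T : T →* M'` has range `T.map u` and kernel `(Ker u).subgroupOf T`
  have hrange : (u.restrict T).range = T.map u := by
    ext y
    simp only [MonoidHom.mem_range, MonoidHom.restrict_apply, Subgroup.mem_map, Subtype.exists, exists_prop]
  have hker : (u.restrict T).ker = u.ker.subgroupOf T := by
    ext x
    simp only [MonoidHom.mem_ker, MonoidHom.restrict_apply, Subgroup.mem_subgroupOf]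
  have h1 : Nat.card (T.map u) = Nat.card (T ⧸ (u.restrict T).ker) := by
    rw [← hrange]
    exact (Nat.card_congr (QuotientGroup.quotientKerEquivRange (u.restrict T)).toEquiv).symm
  have h2 : Nat.card ↥(T ⊓ u.ker) = Nat.card (u.restrict T).ker := by
    rw [hker, ← Subgroup.inf_subgroupOf_left]
    exact (Nat.card_congr (Subgroup.subgroupOfEquivOfLe (inf_le_left : T ⊓ u.ker ≤ T)).toEquiv).symm
  rw [h1, h2]
  exact (Subgroup.card_eq_card_quotient_mul_card_subgroup (u.restrict T).ker).symm

variable {u T} in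
/-- **IMAGE ORDER IN NUMBERS**: `#T = n · m` and `#(T ∩ Ker u) = m` (with `m ≠ 0`, e.g. `T` finite) give `#u(T) = n` (the line: `q² = q · q`).
[cite: BourbakiAlgebraI1989, Ch. I §4 no. 6 Th. 4] -/
theorem natCard_map_eq_of_natCard_eq {n m : ℕ} (hm : m ≠ 0) (hT : Nat.card T = n * m) (hK : Nat.card ↥(T ⊓ u.ker) = m) :
    Nat.card (T.map u) = n := by
  have h := natCard_map_mul_natCard_inf_ker u T
  rw [hK, hT] at h
  exact Nat.eq_of_mul_eq_mul_right (Nat.pos_of_ne_zero hm) h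

section Operators

variable {σ : Type*} (f : σ → M → M) (f' : σ → M' → M') (hf : ∀ a x, u (f a x) = f' a (u x))

include hf in
/-- **STABILITY TRANSPORTED**: if `u` intertwines `f a` and `f′ a` and `T` is `f a`-stable, then `u(T)` is `f′ a`-stable. [cite: BourbakiAlgebraI1989, Ch. I §4 no. 2 Def. 2–3 and no. 3 Def. 4] -/
theorem map_mem_map_of_semiconj (hT : ∀ a, ∀ x ∈ T, f a x ∈ T) (a : σ) (y : M') (hy : y ∈ T.map u) : f' a y ∈ T.map u := by
  obtain ⟨x, hx, rfl⟩ := Subgroup.mem_map.1 hy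
  exact Subgroup.mem_map.2 ⟨f a x, hT a x hx, hf a x⟩

include hf in
/-- **TORSION TRANSPORTED**: if every `x ∈ T` has `f a x = 1` for all `a ∈ 𝔞`, then every `y ∈ u(T)` has `f′ a y = 1` for all `a ∈ 𝔞` (`u 1 = 1`). [cite: BourbakiAlgebraI1989, Ch. I §4 no. 2 Def. 2–3] -/
theorem forall_eq_one_of_mem_map {ι : Type*} [SetLike ι σ] (𝔞 : ι) (hT : ∀ x ∈ T, ∀ a ∈ 𝔞, f a x = 1)
    (y : M') (hy : y ∈ T.map u) : ∀ a ∈ 𝔞, f' a y = 1 := by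
  obtain ⟨x, hx, rfl⟩ := Subgroup.mem_map.1 hy
  intro a ha
  rw [← hf, hT x hx a ha, map_one]

include hf in
/-- **THE IMAGE OF A STABLE TORSION SUBGROUP IS A MEMBER OF THE TARGET CARRIER** (★ (TR) shape `{H // #H = n ∧ (∀ y ∈ H, p y) ∧ ∀ a y, y ∈ H → f′ a y ∈ H}` with
`p y := ∀ a ∈ 𝔞, f′ a y = 1`): for `T ≤ M` with `#T = n·m`, `#(T ∩ Ker u) = m ≠ 0`, `T` `f`-stable and killed by `𝔞`, and `u` intertwining `f`, `f′`,
the subgroup `u(T)` has order `n`, is killed by `𝔞` and is `f′`-stable.  (The IMAGE LINE `L_img = u(A_y[𝔭_{c•w}])` of the L2 letter [R].)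
[cite: BourbakiAlgebraI1989, Ch. I §4 no. 6 Th. 4] [cite: Tate1997FiniteFlatGroupSchemes, (3.7)] -/
theorem exists_stableSubgroup_image {ι : Type*} [SetLike ι σ] (𝔞 : ι) {n m : ℕ} (hm : m ≠ 0)
    (hT : Nat.card T = n * m) (hK : Nat.card ↥(T ⊓ u.ker) = m) (hTa : ∀ x ∈ T, ∀ a ∈ 𝔞, f a x = 1) (hTf : ∀ a, ∀ x ∈ T, f a x ∈ T) :
    ∃ E : {H : Subgroup M' // Nat.card H = n ∧ (∀ y ∈ H, ∀ a ∈ 𝔞, f' a y = 1) ∧ ∀ a, ∀ y ∈ H, f' a y ∈ H}, (E.1 : Subgroup M') = T.map u :=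
  ⟨⟨T.map u, natCard_map_eq_of_natCard_eq hm hT hK, forall_eq_one_of_mem_map u T f f' hf 𝔞 hTa,
    fun a y hy => map_mem_map_of_semiconj u T f f' hf hTf a y hy⟩, rfl⟩

end Operators

end Literature.GroupTheory.StableSubgroups
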